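import Literature.Probability.RandomPlanarGeometry.HullApproximationProofs
import HarnessLib

/-!
# Crux `SAWDevelopingMap.ObservableToSLE` (stmt-CriticalPhenomena-10472), line
`floor-ratio-restriction-bootstrap`: thin smooth hulls around one-sided `*`-hulls (helper for STUB 4b)

Landing target:
`Summits/CriticalPhenomena/SAWScalingLimit/Theorems/SAWDevelopingMapObservableToSLEHullApproxArcs.lean`
(`--supports stmt-CriticalPhenomena-10472`).

For the "hull approximation from outside" (STUB 4b, `stub_hullApproxDomain`) every cluster
`C ∈ 𝒬₊ ∪ 𝒬₋` of the given hull is enclosed in a smooth hull (`IsArcHull`) inside a prescribed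
open neighbourhood `U` of its real filling `C' = realFill C` (`stub_hullApproxDomain_arcs`): by
[LSW] Lemma 2.1 as proved in the tree (`IsPlusHull.exists_antitone_isArcHull_holds`) a nonempty
`C ∈ 𝒬₊` has decreasing smooth hulls `J_n ⊇ C` with `⋂ J_n = C'`, and a compact set missing `C'`
(here `J_0 ∖ U`) misses `J_n` for large `n`; the `𝒬₋` case follows by the reflection `σ` about
the imaginary axis (`realFill (σ C) ⊆ σ (realFill C)`, `IsArcHull.image_imagAxisRefl`).
-/

noncomputable section

open Set Filter Topology Metric Complex Function
open Literature.Probability.RandomPlanarGeometry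
open UpperHalfPlane (upperHalfPlaneSet)

namespace Summit.CriticalPhenomena.SAWScalingLimit.Theorems.ObservableToSLE.FloorRatio

/-- The real trace of the reflected set is the negative of the real trace. [folklore] -/
theorem mem_realTrace_image_imagAxisRefl {C : Set ℂ} {x : ℝ} :
    x ∈ realTrace (imagAxisRefl '' C) ↔ -x ∈ realTrace C := by
  rw [mem_realTrace, mem_realTrace, ← imagAxisRefl_preimage, mem_preimage, imagAxisRefl_ofReal]

/-- `realTrace (σ C) = -(realTrace C)`. [folklore] -/
theorem realTrace_image_imagAxisRefl (C : Set ℂ) :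
    realTrace (imagAxisRefl '' C) = -realTrace C := by
  ext x
  rw [mem_realTrace_image_imagAxisRefl, Set.mem_neg]

/-- **The real filling of the reflected hull lies in the reflection of the real filling.**
[folklore] -/
theorem realFill_image_imagAxisRefl_subset (C : Set ℂ) :
    realFill (imagAxisRefl '' C) ⊆ imagAxisRefl '' realFill C := by
  rintro w (hw | ⟨x, hx, rfl⟩)
  · exact image_mono (subset_realFill C) hw
  · rw [realTrace_image_imagAxisRefl, Real.sInf_neg, Real.sSup_neg] at hx
    refine ⟨((-x : ℝ) : ℂ), Or.inr ⟨-x, ⟨by linarith [hx.2], by linarith [hx.1]⟩, rfl⟩, ?_⟩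
    rw [imagAxisRefl_ofReal, neg_neg]

/-- **A thin smooth hull around a nonempty `+`-hull**: for `C ∈ 𝒬₊` nonempty and an open
`U ⊇ realFill C` there is a smooth hull `J ∌ 0` with `C ⊆ J ⊆ U` ([LSW] Lemma 2.1 as proved in
the tree, `IsPlusHull.exists_antitone_isArcHull_holds`, and compactness).
[cite: LawlerSchrammWerner2003Restriction, Lemma 2.1 (p. 8)] -/
theorem exists_isArcHull_subset_of_isPlusHull {C U : Set ℂ} (hC : IsPlusHull C) (hne : C.Nonempty)
    (hU : IsOpen U) (hRU : realFill C ⊆ U) :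
    ∃ J : Set ℂ, IsArcHull J ∧ (0 : ℂ) ∉ J ∧ C ⊆ J ∧ J ⊆ U := by
  obtain ⟨J, hJa, hJp, hJm, hJi, -⟩ := IsPlusHull.exists_antitone_isArcHull_holds hC hne
  have hJc : ∀ n, IsClosed (J n) := fun n ↦ (hJa n).isBoundedHull.isClosed
  have hK : IsCompact (J 0 \ U) := (hJa 0).isBoundedHull.isCompact.diff hU
  have hKd : Disjoint (J 0 \ U) (realFill C) :=
    Set.disjoint_left.2 fun z hz hzR ↦ hz.2 (hRU hzR)
  obtain ⟨n, hn⟩ := (eventually_disjoint_of_iInter_eq hJc hJm hJi hK hKd).exists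
  refine ⟨J n, hJa n, (hJp n).1.zero_notMem,
    (subset_realFill C).trans (subset_of_iInter_eq hJi n), fun z hz ↦ ?_⟩
  by_contra hzU
  exact Set.disjoint_left.1 hn ⟨hJm (Nat.zero_le n) hz, hzU⟩ hz

/-- **A thin smooth hull around a nonempty one-sided `*`-hull**: for `C ∈ 𝒬₊ ∪ 𝒬₋` nonempty and
an open `U ⊇ realFill C` there is a smooth hull `J ∌ 0` with `C ⊆ J ⊆ U` (the `𝒬₋` case by the
reflection about the imaginary axis). Registered sub-goal `stub_hullApproxDomain_arcs` of STUB 4b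
(`stub_hullApproxDomain`). [cite: LawlerSchrammWerner2003Restriction, Lemma 2.1 (p. 8)] -/
theorem stub_hullApproxDomain_arcs :
    ∀ (C U : Set ℂ), (IsPlusHull C ∨ IsMinusHull C) → C.Nonempty → IsOpen U → realFill C ⊆ U →
      ∃ J : Set ℂ, IsArcHull J ∧ (0 : ℂ) ∉ J ∧ C ⊆ J ∧ J ⊆ U := by
  intro C U hC hne hU hRU
  rcases hC with hC | hC
  · exact exists_isArcHull_subset_of_isPlusHull hC hne hU hRU
  · have hC' : IsPlusHull (imagAxisRefl '' C) := hC.image_imagAxisRefl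
    have hU' : IsOpen (imagAxisRefl '' U) := imagAxisRefl.isOpenMap U hU
    have hRU' : realFill (imagAxisRefl '' C) ⊆ imagAxisRefl '' U :=
      (realFill_image_imagAxisRefl_subset C).trans (image_mono hRU)
    obtain ⟨J, hJa, h0J, hCJ, hJU⟩ := exists_isArcHull_subset_of_isPlusHull hC' (hne.image _) hU' hRU'
    refine ⟨imagAxisRefl '' J, hJa.image_imagAxisRefl, ?_, ?_, ?_⟩
    · rintro ⟨w, hw, hw0⟩
      have : w = 0 := by simpa using congrArg imagAxisRefl hw0
      exact h0J (this ▸ hw)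
    · rw [← imagAxisRefl_image_image C]
      exact image_mono hCJ
    · rw [← imagAxisRefl_image_image U]
      exact image_mono hJU

end Summit.CriticalPhenomena.SAWScalingLimit.Theorems.ObservableToSLE.FloorRatio

end
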